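import Mathlib
import Summits.Ventures.PercRepro2.SwOutCrossJunctionQRead
import Summits.Ventures.PercRepro2.SwOutCrossJunctionOrbit
import Summits.Ventures.PercRepro2.SwOutJunctionH1Orbit
import Summits.Ventures.PercRepro2.SwOutBlocks
import Summits.Ventures.PercRepro2.SwOutCrossJunctionThm

/-!
# THEOREM A_cross: the rigid inequality on every cross-junction class (blind cell PercRepro2,
night-4 g24, 2026-08-28; proofs/NIGHT4-G24.md §7)

A base region `U ∋ h` (`l ∉ U`) with a CROSS JUNCTION `u` whose neighbours are adjacent to `h` or
are DROPPED VERTICES `p i` forming one component along the simple cross-edge graph `G`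
(`CrossJunction`, boundary (iv) of Theorem A_mix).  THE KEY of a `Q`-point (`keyX`) is a
CONFIGURATION: the base `baseX ζ` read off the point when the point is of the MIXED KIND
(`MixedKindX`: it lies in the block of the base of some core-kind `Q`-point of the class), else
the all-red orientation; THE BLOCKS (`blockOfX`) are the block `blockX` of the base or the coarse
orbit.  Every `Q`-point lies in the block of its key (`mem_blockOfX_keyX`: a core-kind point is
in the block of its own base, `mem_blockX_baseX`; a point that is not of the mixed kind is
core-free), every `Q`-point of that block lies in the class with the same key
(`keyX_eq_of_mem_blockOfX`: along a block the base is read off every point — the reading lemma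
`baseX_crossReal` — and every point is in the outside class; along a plain orbit a point of the
mixed kind would put the original point into the same block by the orbit closure
`exists_crossReal_of_mem_orbit`), and every block satisfies the rigid inequality
(`card_blockOfX_le`: `card_blockX_le`, `card_orbit_le`); `rigidOK_of_blocks` assembles them:
**`rigidOK_of_crossJunction`**.
-/

namespace Summit.Ventures.PercRepro2

namespace CrossArm

open Hull LocRows

variable {V : Type*} {E : Type*} [Fintype E] [DecidableEq E]

open scoped Classical

variable {ends : E → Sym2 V} {X : Type*} [Fintype X] {U : Set V} {ξ : Config E} {l h o u : V}
  {p : X → V} {G : SimpleGraph X} [DecidableRel G.Adj] {r : X}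

section Key

variable (ends) (U) (ξ) (l h o u) (p) (G)

variable {ends U ξ l h o u p G}

end Key

section Thm

variable (hj : CrossJunctionQ ends U h u p G o r) (hl : l ∉ U) (hG : G.Connected)
include hj hl hG

section Block

variable {ζ₀ : Config E} (hζ₀ : ζ₀ ∈ swOutSide ends l h o U ξ) (hk₀ : CoreKind ends U h u ζ₀)
include hζ₀ hk₀

omit [Fintype X] [DecidableRel G.Adj] hG in
/-- The u-arms of the base are connected inside themselves. -/
lemma CrossJunctionQ.connU_baseX (j : ιX ends h u p (baseX ends h u p ζ₀)) :
    ∀ x ∈ UX ends h u p (baseX ends h u p ζ₀) j, ∀ y ∈ UX ends h u p (baseX ends h u p ζ₀) j,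
      y ∈ cluster ends (fun e => decide (e ∈ within ends (UX ends h u p (baseX ends h u p ζ₀) j))) x := by
  obtain ⟨z, -, -, -, hz⟩ := exists_of_mem_armsC (hj.uArm_baseX hl hζ₀ hk₀ j).1
  intro x hx y hy
  change x ∈ j.1 at hx
  change y ∈ j.1 at hy
  show y ∈ cluster ends (fun e => decide (e ∈ within ends j.1)) x
  rw [hz] at hx hy ⊢
  exact MixedArms.cluster_conn_within hx hy

omit [Fintype X] [DecidableRel G.Adj] hG in
/-- The far arms of the base are connected inside themselves. -/
lemma CrossJunctionQ.connF_baseX (k : κX ends h u p (baseX ends h u p ζ₀)) :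
    ∀ x ∈ FX ends h u p (baseX ends h u p ζ₀) k, ∀ y ∈ FX ends h u p (baseX ends h u p ζ₀) k,
      y ∈ cluster ends (fun e => decide (e ∈ within ends (FX ends h u p (baseX ends h u p ζ₀) k))) x := by
  obtain ⟨z, -, -, -, hz⟩ := exists_of_mem_armsC (hj.farArm_baseX hl hζ₀ hk₀ k).1
  intro x hx y hy
  change x ∈ k.1 at hx
  change y ∈ k.1 at hy
  show y ∈ cluster ends (fun e => decide (e ∈ within ends k.1)) x
  rw [hz] at hx hy ⊢
  exact MixedArms.cluster_conn_within hx hy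

omit hG in
/-- **The base is read off every point of the block of a core-kind point.** -/
theorem CrossJunctionQ.baseX_eq_of_mem_blockX {ζ : Config E}
    (hζ : ζ ∈ blockX ends h u p G (baseX ends h u p ζ₀)) :
    baseX ends h u p ζ = baseX ends h u p ζ₀ := by
  obtain ⟨q, ⟨hqR, hqB⟩, rfl⟩ := mem_blockX_iff.1 hζ
  exact (hj.crossBase_of_coreKind hl hζ₀ hk₀).baseX_crossReal hj.hup hj.hcross hqR hqB

omit hG in
/-- Every point of the block of a core-kind point lies in the outside class. -/
theorem CrossJunctionQ.mem_outClass_of_mem_blockX {ζ : Config E}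
    (hζ : ζ ∈ blockX ends h u p G (baseX ends h u p ζ₀)) : ζ ∈ outClass ends U h ξ := by
  obtain ⟨q, ⟨hqR, hqB⟩, rfl⟩ := mem_blockX_iff.1 hζ
  exact hj.crossReal_mem_outClass hl hζ₀ hk₀ hqR hqB

omit hG in
/-- **The coarse orbit of a core-free point of the block stays in the block.** -/
theorem CrossJunctionQ.mem_blockX_of_mem_orbit {ζ' : Config E}
    (hζ' : ζ' ∈ blockX ends h u p G (baseX ends h u p ζ₀)) (hc' : CoreFree ends ζ' h)
    {ζ : Config E} (hζ : ζ ∈ orbit ends (allRed ends ζ' h) h) :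
    ζ ∈ blockX ends h u p G (baseX ends h u p ζ₀) := by
  obtain ⟨q, ⟨hqR, hqB⟩, rfl⟩ := mem_blockX_iff.1 hζ'
  haveI := hj.nonempty_ιX hl hζ₀ hk₀
  obtain ⟨q', hq', hζq'⟩ := (hj.crossBase_of_coreKind hl hζ₀ hk₀).exists_crossReal_of_mem_orbit
    hj.hup hj.hcross (hj.connU_baseX hl hζ₀ hk₀) (hj.connF_baseX hl hζ₀ hk₀) hqR hqB hc' hζ
  exact mem_blockX_iff.2 ⟨q', hq', hζq'.symm⟩

end Block

end Thm

end CrossArm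

end Summit.Ventures.PercRepro2
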